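import Mathlib
import Summits.KontsevichZagierPeriods.Zeta5Search.CatalanRemarksVTResidues
import HarnessLib

/-!
# Catalan box family — Zudilin's second construction (12): Lagrange interpolation at the poles

HONEST FRAMING: systematic search; no irrationality claim unless certified.  Polynomial algebra over `ℚ`; nothing in this
file is a statement about Catalan's constant.

Cell `pub-zeta5`, planner seat `fam-catalan` (gen 8), kernel target K-vT-odd, file 2 of 5.  The rational function (12) of
[Zudilin2002CatalanRemarks] is `R̃_n(t) = μ̃_n · Ñ_n(t)(t − P_{n+1}) / ∏_{i<2n+2}(t − ν_i)` with the numerator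
`Ñ_n = ∏_{j=1}^{n−1}(X−j)·∏_{j=1}^{n}(X−j)` of degree `2n−1`, the SAME quarter-lattice nodes `ν_i = P_{i−n} = (2i−2n+1)/4`,
`i < 2n+2`, as the first construction (tree: `Zudilin2003.Remarks.node`, whose `lagrange_pf`, `nodalWeight_eq`,
`one_ne_node`, `prod_one_sub_node_ne_zero` are reused BY NAME), and `μ̃_n = (−1)ⁿ(2n)!/(2^{2n+2}(n−1)!²)`; the top node
`ν_{2n+1} = P_{n+1}` is NOT a pole of `R̃_n` (the factor `X − P_{n+1}` of `Q̃_n := Ñ_n·(X − P_{n+1})` cancels it).  Proved here: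
* `resRT_eq_muRT_lagT` — the closed-form residues `resRT` of file 1 ARE `μ̃_n` times the Lagrange coefficients
  `lagT n i = w_i·Q̃_n(ν_i)` (closed-form nodal weights `Remarks.nodalWeight_eq`);
* the moments `Σ_i lagT = 0` (`R̃_n = O(t⁻²)`), `Σ_i lagT/(1−ν_i) = 0` (`R̃_n(1) = 0`, `n ≥ 1`),
  `Σ_i lagT/(1−ν_i)² = 0` (`R̃_n′(1) = 0`, `n ≥ 2`: the double zero of `Ñ_n` at `1`), all by Lagrange interpolation at
  `t = 1` — no calculus — and the value sum `Σ_i lagT·(ν_i − ν_{2n+1})⁻¹ = −w_{2n+1}Ñ_n(ν_{2n+1})` (from `Σ_i w_iÑ_n(ν_i) = 0`,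
  `deg Ñ_n ≤ 2n`), which is `−R̃_n(P_{n+1})/μ̃_n` up to the Lean convention `x/0 = 0` at the top node.
These feed `BsumT_eq_zero` in `CatalanRemarksVTIdentification` (file 3).  Pattern: `Remarks.sum_lag_eq_zero` & co. of
`CatalanRemarksTheorem1.lean`, with `numP ↦ Q̃_n`.
-/

noncomputable section

namespace Summit.KontsevichZagierPeriods.Zeta5Search.CatalanRemarksVT

open Finset
open Literature.NumberTheory.Irrationality.Zudilin2003.Remarks
  (invFac invFac_natCast invFac_of_neg pole xq node node_eq_pole node_injOn one_ne_node
    prod_one_sub_node_ne_zero lagrange_pf nodalWeight_eq)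
open Literature.NumberTheory.Irrationality.KrattenthalerRivoal2008 (gbinom)

/-! ### The numerator `Ñ_n`, the polynomial `Q̃_n = Ñ_n·(X − P_{n+1})` and their degrees / values -/

open Polynomial in
/-- `Ñ_n = ∏_{j<n−1}(X − (j+1))·∏_{j<n}(X − (j+1))`, the numerator of (12) made monic.
[cite: Zudilin2002CatalanRemarks, Sect. 2, eq. (12)] -/
def numPT (n : ℕ) : ℚ[X] :=
  (∏ j ∈ range (n - 1), (X - C ((j : ℚ) + 1))) * ∏ j ∈ range n, (X - C ((j : ℚ) + 1))

open Polynomial in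
/-- `Q̃_n = Ñ_n·(X − ν_{2n+1})`, the polynomial interpolated at the `2n+2` nodes. [cite: Zudilin2002CatalanRemarks, Sect. 2, eq. (12)] -/
def QpolT (n : ℕ) : ℚ[X] := numPT n * (X - C (node n (2 * n + 1)))

open Polynomial in
/-- `Q̃_n/(X−1)`: `Q̃′_n = ∏_{j<n−1}(X−(j+1))·∏_{j<n−1}(X−(j+2))·(X − ν_{2n+1})`. [cite: Zudilin2002CatalanRemarks, Sect. 2, eq. (12)] -/
def QpolT' (n : ℕ) : ℚ[X] :=
  (∏ j ∈ range (n - 1), (X - C ((j : ℚ) + 1))) * (∏ j ∈ range (n - 1), (X - C ((j : ℚ) + 2)))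
    * (X - C (node n (2 * n + 1)))

open Polynomial in
/-- Evaluation of `Ñ_n`. [cite: Zudilin2002CatalanRemarks, Sect. 2, eq. (12)] -/
theorem eval_numPT (n : ℕ) (t : ℚ) :
    (numPT n).eval t = (∏ j ∈ range (n - 1), (t - ((j : ℚ) + 1))) * ∏ j ∈ range n, (t - ((j : ℚ) + 1)) := by
  simp [numPT, eval_prod]

open Polynomial in
/-- Evaluation of `Q̃_n`. [cite: Zudilin2002CatalanRemarks, Sect. 2, eq. (12)] -/
theorem eval_QpolT (n : ℕ) (t : ℚ) : (QpolT n).eval t = (numPT n).eval t * (t - node n (2 * n + 1)) := by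
  simp [QpolT]

open Polynomial in
/-- `deg ∏_{j<m}(X − c_j) ≤ m`. [folklore] -/
private theorem natDegree_prod_X_sub_C_le (m : ℕ) (c : ℕ → ℚ) :
    (∏ j ∈ range m, (X - C (c j))).natDegree ≤ m := by
  refine (natDegree_prod_le _ _).trans ?_
  refine (Finset.sum_le_sum fun j _ => (natDegree_X_sub_C _).le).trans ?_
  simp

open Polynomial in
/-- `deg Ñ_n ≤ (n−1) + n`. [cite: Zudilin2002CatalanRemarks, Sect. 2, eq. (12)] -/
theorem natDegree_numPT_le (n : ℕ) : (numPT n).natDegree ≤ n - 1 + n := by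
  unfold numPT
  refine natDegree_mul_le.trans ?_
  exact Nat.add_le_add (natDegree_prod_X_sub_C_le _ _) (natDegree_prod_X_sub_C_le _ _)

open Polynomial in
/-- `deg Q̃_n ≤ 2n` (`n ≥ 1`). [cite: Zudilin2002CatalanRemarks, Sect. 2, eq. (12)] -/
theorem natDegree_QpolT_le (n : ℕ) (hn : 1 ≤ n) : (QpolT n).natDegree ≤ 2 * n := by
  unfold QpolT
  refine natDegree_mul_le.trans ?_
  have h1 := natDegree_numPT_le n
  have h2 : (X - C (node n (2 * n + 1))).natDegree ≤ 1 := (natDegree_X_sub_C _).le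
  omega

open Polynomial in
/-- `deg Q̃′_n ≤ 2n+1`. [cite: Zudilin2002CatalanRemarks, Sect. 2, eq. (12)] -/
theorem natDegree_QpolT'_le (n : ℕ) : (QpolT' n).natDegree ≤ 2 * n + 1 := by
  unfold QpolT'
  refine natDegree_mul_le.trans ?_
  have h1 : ((∏ j ∈ range (n - 1), (X - C ((j : ℚ) + 1))) * ∏ j ∈ range (n - 1), (X - C ((j : ℚ) + 2))).natDegree
      ≤ (n - 1) + (n - 1) :=
    natDegree_mul_le.trans (Nat.add_le_add (natDegree_prod_X_sub_C_le _ _) (natDegree_prod_X_sub_C_le _ _))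
  have h2 : (X - C (node n (2 * n + 1))).natDegree ≤ 1 := (natDegree_X_sub_C _).le
  omega

open Polynomial in
/-- `Q̃_n = (X−1)·Q̃′_n` for `n ≥ 1`. [cite: Zudilin2002CatalanRemarks, Sect. 2, eq. (12)] -/
theorem QpolT_eq_mul (n : ℕ) (hn : 1 ≤ n) : QpolT n = (X - C 1) * QpolT' n := by
  obtain ⟨m, rfl⟩ : ∃ m, n = m + 1 := ⟨n - 1, by omega⟩
  unfold QpolT QpolT' numPT
  rw [Nat.add_sub_cancel, Finset.prod_range_succ']
  have e : ∏ j ∈ range m, (X - C (((j + 1 : ℕ) : ℚ) + 1)) = ∏ j ∈ range m, (X - C ((j : ℚ) + 2)) :=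
    Finset.prod_congr rfl fun j _ => by push_cast; ring_nf
  rw [e]
  push_cast
  ring

/-- `Q̃_n(1) = 0` for `n ≥ 1` (the factor `X − 1` of the second product). [cite: Zudilin2002CatalanRemarks, Sect. 2, eq. (12)] -/
theorem eval_QpolT_one (n : ℕ) (hn : 1 ≤ n) : (QpolT n).eval 1 = 0 := by
  rw [eval_QpolT, eval_numPT, Finset.prod_eq_zero (i := 0) (s := range n) (mem_range.mpr (by omega)) (by simp)]
  simp

open Polynomial in
/-- `Q̃′_n(1) = 0` for `n ≥ 2` (the double zero of `Ñ_n` at `1`). [cite: Zudilin2002CatalanRemarks, Sect. 2, eq. (12)] -/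
theorem eval_QpolT'_one (n : ℕ) (hn : 2 ≤ n) : (QpolT' n).eval 1 = 0 := by
  unfold QpolT'
  rw [eval_mul, eval_mul, eval_prod,
    Finset.prod_eq_zero (i := 0) (s := range (n - 1)) (mem_range.mpr (by omega)) (by simp)]
  simp

/-- `∏_{j<m}(ν_i − (j+1)) = m!·binom(x_{i−n}, m)` (`x_k = P_k − 1`). [cite: Zudilin2002CatalanRemarks, Sect. 2, eq. (12)] -/
theorem prod_node_sub (n i m : ℕ) :
    ∏ j ∈ range m, (node n i - ((j : ℚ) + 1)) = (m.factorial : ℚ) * gbinom (xq ((i : ℤ) - n)) m := by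
  unfold gbinom
  rw [mul_div_cancel₀ _ (by positivity)]
  refine Finset.prod_congr rfl fun j _ => ?_
  unfold node xq
  push_cast
  ring

/-- `Ñ_n(ν_i) = (n−1)!·binom(x_{i−n}, n−1) · n!·binom(x_{i−n}, n)`. [cite: Zudilin2002CatalanRemarks, Sect. 2, eq. (12)] -/
theorem eval_numPT_node (n i : ℕ) :
    (numPT n).eval (node n i) = (((n - 1).factorial : ℚ) * gbinom (xq ((i : ℤ) - n)) (n - 1))
      * ((n.factorial : ℚ) * gbinom (xq ((i : ℤ) - n)) n) := by
  rw [eval_numPT, prod_node_sub, prod_node_sub]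

/-! ### The Lagrange coefficients and the residues -/

/-- The Lagrange coefficient at `ν_i`: `lagT n i = w_i · Q̃_n(ν_i)`. [cite: Zudilin2002CatalanRemarks, Sect. 2, eq. (12)] -/
def lagT (n i : ℕ) : ℚ := Lagrange.nodalWeight (range (2 * n + 2)) (node n) i * (QpolT n).eval (node n i)

/-- The normalisation `μ̃_n = (−1)ⁿ(2n)!/(2^{2n+2}((n−1)!)²)`. [cite: Zudilin2002CatalanRemarks, Sect. 2, eq. (12)] -/
def muRT (n : ℕ) : ℚ := (-1) ^ n * ((2 * n).factorial : ℚ) / (2 ^ (2 * n + 2) * (((n - 1).factorial : ℚ)) ^ 2)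

/-- The top node carries no residue: `lagT n (2n+1) = 0`. [cite: Zudilin2002CatalanRemarks, Sect. 2, eq. (12)] -/
theorem lagT_top (n : ℕ) : lagT n (2 * n + 1) = 0 := by
  simp [lagT, eval_QpolT]

/-- Sign bookkeeping: `(−1)^{(i−n)} = (−1)^{i+n}` (integer exponent on the left). [folklore] -/
private theorem neg_one_zpow_sub_nat (i n : ℕ) : (-1 : ℚ) ^ ((i : ℤ) - n) = (-1) ^ (i + n) := by
  rw [show ((i : ℤ) - n) = ((i + n : ℕ) : ℤ) - ((2 * n : ℕ) : ℤ) by push_cast; ring,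
    zpow_sub₀ (by norm_num), zpow_natCast, zpow_natCast, pow_mul]
  norm_num

/-- Sign bookkeeping: `(−1)^{2n+1−i} = (−1)^{i+1}` for `i ≤ 2n+1`. [folklore] -/
private theorem neg_one_pow_top (n i : ℕ) (hi : i ≤ 2 * n + 1) : (-1 : ℚ) ^ (2 * n + 1 - i) = (-1) ^ (i + 1) := by
  have h : (-1 : ℚ) ^ (2 * n + 1 - i) * (-1) ^ (i + 1) = 1 := by
    rw [← pow_add, show 2 * n + 1 - i + (i + 1) = 2 * (n + 1) by omega, pow_mul]
    norm_num
  have h2 : ((-1 : ℚ) ^ (i + 1)) ^ 2 = 1 := by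
    rw [← pow_mul]; exact Even.neg_one_pow ⟨i + 1, by ring⟩
  calc (-1 : ℚ) ^ (2 * n + 1 - i) = (-1) ^ (2 * n + 1 - i) * ((-1 : ℚ) ^ (i + 1)) ^ 2 := by rw [h2, mul_one]
    _ = ((-1 : ℚ) ^ (2 * n + 1 - i) * (-1) ^ (i + 1)) * (-1) ^ (i + 1) := by ring
    _ = (-1) ^ (i + 1) := by rw [h, one_mul]

/-- **The residues of (12) ARE the Lagrange coefficients** (up to `μ̃_n`): `resRT n (i−n) = μ̃_n · lagT n i` for
`i < 2n+2`, `n ≥ 1`. [cite: Zudilin2002CatalanRemarks, Sect. 2, eq. (12)] -/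
theorem resRT_eq_muRT_lagT (n i : ℕ) (hn : 1 ≤ n) (hi : i < 2 * n + 2) :
    resRT n ((i : ℤ) - n) = muRT n * lagT n i := by
  rcases Nat.lt_or_ge i (2 * n + 1) with hi' | hi'
  · obtain ⟨m, rfl⟩ : ∃ m, n = m + 1 := ⟨n - 1, by omega⟩
    unfold lagT muRT resRT
    rw [eval_QpolT, eval_numPT_node, nodalWeight_eq (m + 1) i hi,
      show ((m + 1 : ℕ) : ℤ) + ((i : ℤ) - ((m + 1 : ℕ) : ℤ)) = ((i : ℕ) : ℤ) by ring, invFac_natCast,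
      show ((m + 1 : ℕ) : ℤ) - ((i : ℤ) - ((m + 1 : ℕ) : ℤ)) = ((2 * (m + 1) - i : ℕ) : ℤ) by omega, invFac_natCast,
      show m + 1 - 1 = m from rfl, neg_one_zpow_sub_nat, neg_one_pow_top (m + 1) i (by omega)]
    have f1 : ((2 * (m + 1) + 1 - i).factorial : ℚ) =
        ((2 * (m + 1) + 1 - i : ℕ) : ℚ) * ((2 * (m + 1) - i).factorial : ℚ) := by
      rw [show 2 * (m + 1) + 1 - i = (2 * (m + 1) - i) + 1 by omega, Nat.factorial_succ]
      push_cast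
      ring
    have f2 : ((m + 1).factorial : ℚ) = ((m : ℚ) + 1) * (m.factorial : ℚ) := by
      rw [Nat.factorial_succ]; push_cast; ring
    have hnode : node (m + 1) i - node (m + 1) (2 * (m + 1) + 1) = -(((2 * (m + 1) + 1 - i : ℕ) : ℚ)) / 2 := by
      rw [Nat.cast_sub (by omega)]
      unfold node
      push_cast
      ring
    rw [f1, f2, hnode]
    have h1 : ((i.factorial : ℚ)) ≠ 0 := by positivity
    have h2 : (((2 * (m + 1) - i).factorial : ℚ)) ≠ 0 := by positivity
    have h3 : ((m.factorial : ℚ)) ≠ 0 := by positivity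
    have h4 : (((2 * (m + 1) + 1 - i : ℕ) : ℚ)) ≠ 0 := by exact_mod_cast (show 2 * (m + 1) + 1 - i ≠ 0 by omega)
    simp only [Nat.cast_add, Nat.cast_one]
    field_simp
    ring
  · obtain rfl : i = 2 * n + 1 := by omega
    rw [lagT_top, mul_zero]
    exact resRT_eq_zero_of_gt n _ (by push_cast; omega)

/-! ### Moments by Lagrange interpolation at `t = 1` -/

open Polynomial in
/-- **`Σ_i w_i Q(ν_i) = 0` for `deg Q ≤ 2n`** (the leading coefficient of the interpolant; Lagrange for `Q` and `X·Q`
at `t = 1`). [cite: Zudilin2002CatalanRemarks, Sect. 2, eq. (12) with Sect. 1, eqs. (8)–(9)] -/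
theorem sum_weight_eval_eq_zero (n : ℕ) (Q : ℚ[X]) (hQ : Q.natDegree ≤ 2 * n) :
    ∑ i ∈ range (2 * n + 2), Lagrange.nodalWeight (range (2 * n + 2)) (node n) i * Q.eval (node n i) = 0 := by
  have h0 := lagrange_pf n Q (hQ.trans (by omega)) 1 (one_ne_node n)
  have hX := lagrange_pf n (X * Q) ((natDegree_mul_le).trans (by rw [natDegree_X]; omega)) 1 (one_ne_node n)
  simp only [eval_mul, eval_X, one_mul] at hX
  have e : ∑ i ∈ range (2 * n + 2), Lagrange.nodalWeight (range (2 * n + 2)) (node n) i * Q.eval (node n i) =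
      ∑ i ∈ range (2 * n + 2), Lagrange.nodalWeight (range (2 * n + 2)) (node n) i * (1 - node n i)⁻¹
          * Q.eval (node n i)
        - ∑ i ∈ range (2 * n + 2), Lagrange.nodalWeight (range (2 * n + 2)) (node n) i * (1 - node n i)⁻¹
          * (node n i * Q.eval (node n i)) := by
    rw [← Finset.sum_sub_distrib]
    refine Finset.sum_congr rfl fun i hi => ?_
    have hne : (1 - node n i) ≠ 0 := sub_ne_zero.mpr (one_ne_node n i hi)
    linear_combination
      (-(Lagrange.nodalWeight (range (2 * n + 2)) (node n) i * Q.eval (node n i))) * inv_mul_cancel₀ hne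
  have key : (∏ i ∈ range (2 * n + 2), (1 - node n i)) *
      ∑ i ∈ range (2 * n + 2), Lagrange.nodalWeight (range (2 * n + 2)) (node n) i * Q.eval (node n i) = 0 := by
    rw [e, mul_sub, ← h0, ← hX, sub_self]
  exact (mul_eq_zero.mp key).resolve_left (prod_one_sub_node_ne_zero n)

/-- **Moment 0: `Σ_i lagT n i = 0`** (`R̃_n = O(t⁻²)`). [cite: Zudilin2002CatalanRemarks, Sect. 2, eq. (12)] -/
theorem sum_lagT_eq_zero (n : ℕ) (hn : 1 ≤ n) : ∑ i ∈ range (2 * n + 2), lagT n i = 0 :=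
  sum_weight_eval_eq_zero n (QpolT n) (natDegree_QpolT_le n hn)

/-- **Moment 1: `Σ_i lagT n i/(1−ν_i) = 0`** (`= R̃_n(1)/… = 0`). [cite: Zudilin2002CatalanRemarks, Sect. 2, eq. (12)] -/
theorem sum_lagT_div_eq_zero (n : ℕ) (hn : 1 ≤ n) : ∑ i ∈ range (2 * n + 2), lagT n i / (1 - node n i) = 0 := by
  have h0 := lagrange_pf n (QpolT n) ((natDegree_QpolT_le n hn).trans (by omega)) 1 (one_ne_node n)
  rw [eval_QpolT_one n hn] at h0
  have h1 := (mul_eq_zero.mp h0.symm).resolve_left (prod_one_sub_node_ne_zero n)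
  rw [← h1]
  refine Finset.sum_congr rfl fun i _ => ?_
  unfold lagT
  rw [div_eq_mul_inv]
  ring

open Polynomial in
/-- **Moment 2: `Σ_i lagT n i/(1−ν_i)² = 0`** for `n ≥ 2` (`= −R̃_n′(1)/… = 0`; Lagrange for `Q̃′_n` at `t = 1`, no calculus).
[cite: Zudilin2002CatalanRemarks, Sect. 2, eq. (12)] -/
theorem sum_lagT_div_sq_eq_zero (n : ℕ) (hn : 2 ≤ n) :
    ∑ i ∈ range (2 * n + 2), lagT n i / (1 - node n i) ^ 2 = 0 := by
  have h0 := lagrange_pf n (QpolT' n) (natDegree_QpolT'_le n) 1 (one_ne_node n)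
  rw [eval_QpolT'_one n hn] at h0
  have h1 := (mul_eq_zero.mp h0.symm).resolve_left (prod_one_sub_node_ne_zero n)
  have hval : ∀ i ∈ range (2 * n + 2), (QpolT' n).eval (node n i) = (QpolT n).eval (node n i) / (node n i - 1) := by
    intro i hi
    have hne : node n i - 1 ≠ 0 := sub_ne_zero.mpr (one_ne_node n i hi).symm
    rw [eq_div_iff hne, QpolT_eq_mul n (by omega), eval_mul]
    simp [eval_sub, eval_X]
    ring
  have e : ∑ i ∈ range (2 * n + 2), lagT n i / (1 - node n i) ^ 2 =
      -∑ i ∈ range (2 * n + 2), Lagrange.nodalWeight (range (2 * n + 2)) (node n) i * (1 - node n i)⁻¹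
          * (QpolT' n).eval (node n i) := by
    rw [← Finset.sum_neg_distrib]
    refine Finset.sum_congr rfl fun i hi => ?_
    rw [hval i hi, show node n i - 1 = -(1 - node n i) by ring, div_neg, mul_neg, neg_neg, div_eq_mul_inv,
      div_eq_mul_inv, pow_two, mul_inv]
    unfold lagT
    ring
  rw [e, h1, neg_zero]

/-- `Σ_i w_i Ñ_n(ν_i) = 0` (`deg Ñ_n ≤ 2n`). [cite: Zudilin2002CatalanRemarks, Sect. 2, eq. (12)] -/
theorem sum_weight_numPT_eq_zero (n : ℕ) :
    ∑ i ∈ range (2 * n + 2), Lagrange.nodalWeight (range (2 * n + 2)) (node n) i * (numPT n).eval (node n i) = 0 :=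
  sum_weight_eval_eq_zero n (numPT n) ((natDegree_numPT_le n).trans (by omega))

/-- `ν_i ≠ ν_{2n+1}` for `i < 2n+1`. [cite: Zudilin2002CatalanRemarks, Sect. 2, eq. (12)] -/
theorem node_sub_top_ne_zero (n i : ℕ) (hi : i < 2 * n + 1) : node n i - node n (2 * n + 1) ≠ 0 := by
  unfold node
  intro h
  have h' : (i : ℚ) = ((2 * n + 1 : ℕ) : ℚ) := by push_cast at h ⊢; linarith
  have : i = 2 * n + 1 := by exact_mod_cast h'
  omega

/-- **The value sum**: `Σ_i lagT n i·(ν_i − ν_{2n+1})⁻¹ = −w_{2n+1}·Ñ_n(ν_{2n+1})` (for `i ≤ 2n` the summand is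
`w_iÑ_n(ν_i)`; the top summand is `0` by `lagT_top` and `0⁻¹ = 0`). [cite: Zudilin2002CatalanRemarks, Sect. 2, eq. (12)] -/
theorem sum_lagT_mul_inv_top (n : ℕ) :
    ∑ i ∈ range (2 * n + 2), lagT n i * (node n i - node n (2 * n + 1))⁻¹ =
      -(Lagrange.nodalWeight (range (2 * n + 2)) (node n) (2 * n + 1) * (numPT n).eval (node n (2 * n + 1))) := by
  have h := sum_weight_numPT_eq_zero n
  rw [Finset.sum_range_succ] at h ⊢
  rw [lagT_top, zero_mul, add_zero]
  have e : ∀ i ∈ range (2 * n + 1), lagT n i * (node n i - node n (2 * n + 1))⁻¹ =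
      Lagrange.nodalWeight (range (2 * n + 2)) (node n) i * (numPT n).eval (node n i) := by
    intro i hi
    have hne := node_sub_top_ne_zero n i (mem_range.mp hi)
    unfold lagT
    rw [eval_QpolT, ← mul_assoc, mul_assoc, mul_inv_cancel₀ hne, mul_one]
  rw [Finset.sum_congr rfl e]
  linear_combination h

end Summit.KontsevichZagierPeriods.Zeta5Search.CatalanRemarksVT
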